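import Summits.AnomalousDissipation.AnomalousDissipation.Theorems.SawtoothPulseCascadeK1LocalisedCascadeCornerTraceGeomSums

/-!
# K1loc — helper: THE SCALARS OF THE ALL-ORDERS CORNER-TRACE BOUND IN CLOSED FORM («CT-GEO» 3b/4)

Helper file of the prover lane on the crux `K1LocalisedCascade` (stmt-AnomalousDissipation-19491), route
`SawtoothPulseCascade` (S-D fibre ledger, corner-trace track; finding F-p1g9-1, memo v15).  The three scalar hypotheses of
`…CornerTraceGeomSum.cornerTraceGeom_sum_sq_le` for a window inside `|k| ≤ K`, cut-off support `|l| ≤ L`, weight base `Λ ≥ 0`: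
* **`cornerTraceGeom_tau_le`**: if `λ′ := λ − Λ ≥ K + 1` there are `τ_i` with `Σ_{k∈W, k≡ρ} Φ_Λ(k)Φ_i(k)Λ^i ≤ τ_i` for every `ρ` and
  `Σ_{i<p} τ_i ≤ 8λ′²/(λ′²−K²)² + 8(K+½)/(N(λ′²−(K+½)²))` (`…CornerTraceGeomSums`: monotone residue classes, geometric collapse
  `Φ_Λ ≤ 1/(λ′+k) + 1/(λ′−k)`, discrete telescoping) — the lobe moved to the near edge `λ′` of the cut-off packet, NO residue term;
* `cornerTraceGeom_sigma_le`: `Σ_{k∈W, k≡ρ} ξ_p(k)² ≤ (4/D²)(1/S^{2p} + 1/(NS^{2p−1}))`, `S = D + L` (`p ≥ 1`);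
* `cornerTraceGeom_moment_le`: `Σ_{l∈S, l≡k} |l|^{2p} ≤ (2L/N + 1)L^{2p}`.
No definitions; nothing about the crux. [cite: Grafakos2014, Prop. 3.1.2 (5), §3.1.3] [problem: turb]
-/

-- `Summit.<Summit>.<Problem>`: single-conjunct summit, the duplicate namespace segment is deliberate.
set_option linter.dupNamespace false

noncomputable section

namespace Summit.AnomalousDissipation.AnomalousDissipation.Theorems.SawtoothPulseCascade.K1Window

open Finset
open scoped Real

/-! ## §1 The trace scalars `τ_i` -/

set_option maxHeartbeats 800000 in
/-- **The trace scalars in closed form** (see the file header): `N ≥ 1`, lobe `λ = L₂`, window `W` inside `|k| ≤ K`, order `p`,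
weight base `Λ ≥ 0` with `K + 1 ≤ λ′ := λ − Λ`.  There are `τ_i ≥ 0` bounding `Σ_{k∈W, k≡ρ (N)} Φ_Λ(k)Φ_i(k)Λ^i` for every `ρ`, with
`Σ_{i<p} τ_i ≤ 8λ′²/(λ′²−K²)² + 8(K+½)/(N(λ′²−(K+½)²))`. [cite: Grafakos2014, §3.1.3] -/
theorem cornerTraceGeom_tau_le {N : ℕ} (hN : 0 < N) (L₂ K : ℕ) (W : Finset ℤ) (hW : ∀ k ∈ W, |k| ≤ (K : ℤ)) (p : ℕ)
    {Λ : ℝ} (hΛ : 0 ≤ Λ) (hedge : (K : ℝ) + 1 ≤ (L₂ : ℝ) - Λ) :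
    ∃ τ : ℕ → ℝ, (∀ i ∈ range p, ∀ ρ : ℤ,
      ∑ k ∈ W.filter (fun k => (N : ℤ) ∣ k - ρ),
        (∑ i' ∈ range p, Λ ^ i' * (1 / ((L₂ : ℝ) + k) ^ (i' + 1) + 1 / ((L₂ : ℝ) - k) ^ (i' + 1))) *
          (1 / ((L₂ : ℝ) + k) ^ (i + 1) + 1 / ((L₂ : ℝ) - k) ^ (i + 1)) * Λ ^ i ≤ τ i) ∧
      ∑ i ∈ range p, τ i ≤ 8 * ((L₂ : ℝ) - Λ) ^ 2 / (((L₂ : ℝ) - Λ) ^ 2 - (K : ℝ) ^ 2) ^ 2 +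
        8 * ((K : ℝ) + 1 / 2) / (N * (((L₂ : ℝ) - Λ) ^ 2 - ((K : ℝ) + 1 / 2) ^ 2)) := by
  classical
  have hNr : (0 : ℝ) < N := by exact_mod_cast hN
  set lam' : ℝ := (L₂ : ℝ) - Λ with hlam'
  set Φa : ℕ → ℤ → ℝ := fun i k => 1 / ((L₂ : ℝ) + k) ^ (i + 1) + 1 / ((L₂ : ℝ) - k) ^ (i + 1) with hΦa
  set ΦΛ : ℤ → ℝ := fun k => ∑ i ∈ range p, Λ ^ i * Φa i k with hΦΛ
  set f : ℕ → ℤ → ℝ := fun i k => ΦΛ k * Φa i k * Λ ^ i with hf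
  -- basic facts on `|k| ≤ K`
  have hKL : (K : ℝ) + 1 ≤ L₂ := by linarith
  have hpos : ∀ k : ℤ, |k| ≤ (K : ℤ) → 0 < (L₂ : ℝ) + k ∧ 0 < (L₂ : ℝ) - k := by
    intro k hk
    have hk' : |((k : ℤ) : ℝ)| ≤ K := by exact_mod_cast hk
    have := le_abs_self ((k : ℤ) : ℝ); have := neg_abs_le ((k : ℤ) : ℝ)
    constructor <;> linarith
  have hΦa0 : ∀ i (k : ℤ), |k| ≤ (K : ℤ) → 0 ≤ Φa i k := by
    intro i k hk; obtain ⟨h1, h2⟩ := hpos k hk; simp only [hΦa]; positivity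
  have hΦΛ0 : ∀ k : ℤ, |k| ≤ (K : ℤ) → 0 ≤ ΦΛ k := fun k hk =>
    sum_nonneg fun i _ => mul_nonneg (pow_nonneg hΛ _) (hΦa0 i k hk)
  have hf0 : ∀ i (k : ℤ), 0 ≤ k → k ≤ K → 0 ≤ f i k := fun i k h1 h2 => by
    have hk : |k| ≤ (K : ℤ) := abs_le.mpr ⟨by omega, h2⟩
    simp only [hf]; exact mul_nonneg (mul_nonneg (hΦΛ0 k hk) (hΦa0 i k hk)) (pow_nonneg hΛ _)
  have hΦa_even : ∀ i (k : ℤ), Φa i (-k) = Φa i k := by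
    intro i k; simp only [hΦa]; push_cast; ring
  have hΦΛ_even : ∀ k : ℤ, ΦΛ (-k) = ΦΛ k := by
    intro k; simp only [hΦΛ]; exact sum_congr rfl fun i _ => by rw [hΦa_even]
  have hf_even : ∀ i (k : ℤ), f i (-k) = f i k := by
    intro i k; simp only [hf]; rw [hΦa_even, hΦΛ_even]
  have hΦa_mono : ∀ i (a b : ℤ), 0 ≤ a → a ≤ b → b ≤ K → Φa i a ≤ Φa i b := by
    intro i a b ha hab hb
    simp only [hΦa]
    exact inv_pow_add_inv_pow_mono (i + 1) (by exact_mod_cast ha) (by exact_mod_cast hab)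
      (by have : (b : ℝ) ≤ K := by exact_mod_cast hb
          linarith)
  have hΦΛ_mono : ∀ a b : ℤ, 0 ≤ a → a ≤ b → b ≤ K → ΦΛ a ≤ ΦΛ b := fun a b ha hab hb =>
    sum_le_sum fun i _ => mul_le_mul_of_nonneg_left (hΦa_mono i a b ha hab hb) (pow_nonneg hΛ _)
  have hf_mono : ∀ i (a b : ℤ), 0 ≤ a → a ≤ b → b ≤ K → f i a ≤ f i b := by
    intro i a b ha hab hb
    have hbK : |b| ≤ (K : ℤ) := abs_le.mpr ⟨by omega, hb⟩
    have haK : |a| ≤ (K : ℤ) := abs_le.mpr ⟨by omega, by omega⟩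
    simp only [hf]
    refine mul_le_mul_of_nonneg_right (mul_le_mul (hΦΛ_mono a b ha hab hb) (hΦa_mono i a b ha hab hb)
      (hΦa0 i a haK) (hΦΛ0 b hbK)) (pow_nonneg hΛ _)
  -- the majorants
  refine ⟨fun i => 2 * f i K + 1 / N * ∑ m ∈ Icc (-(K : ℤ)) K, f i m, ?_, ?_⟩
  · intro i _ ρ
    have hsub : W.filter (fun k => (N : ℤ) ∣ k - ρ) ⊆ (Icc (-(K : ℤ)) K).filter (fun k => (N : ℤ) ∣ k - ρ) := by
      intro k hk
      obtain ⟨hkW, hkd⟩ := mem_filter.mp hk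
      exact mem_filter.mpr ⟨mem_Icc.mpr (abs_le.mp (hW k hkW)), hkd⟩
    have h1 : ∑ k ∈ W.filter (fun k => (N : ℤ) ∣ k - ρ), f i k ≤
        ∑ k ∈ (Icc (-(K : ℤ)) K).filter (fun k => (N : ℤ) ∣ k - ρ), f i k :=
      sum_le_sum_of_subset_of_nonneg hsub fun k hk _ => by
        obtain ⟨hkI, -⟩ := mem_filter.mp hk
        obtain ⟨hk1, hk2⟩ := mem_Icc.mp hkI
        have hk : |k| ≤ (K : ℤ) := abs_le.mpr ⟨hk1, hk2⟩
        simp only [hf]; exact mul_nonneg (mul_nonneg (hΦΛ0 k hk) (hΦa0 i k hk)) (pow_nonneg hΛ _)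
    have h2 := sum_residueClass_Icc_le (f i) (K := (K : ℤ)) (by positivity) (hf0 i) (hf_even i) (hf_mono i) hN ρ
    simpa only [hf, hΦΛ, hΦa] using h1.trans h2
  · -- `Σ_i f_i(k) = Φ_Λ(k)² ≤ 4λ′²/(λ′²−k²)²`
    have hsq : ∀ k : ℤ, |k| ≤ (K : ℤ) → ∑ i ∈ range p, f i k ≤ 4 * lam' ^ 2 / (lam' ^ 2 - (k : ℝ) ^ 2) ^ 2 := by
      intro k hk
      obtain ⟨h1, h2⟩ := hpos k hk
      have hk' : |((k : ℤ) : ℝ)| ≤ K := by exact_mod_cast hk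
      have hka := le_abs_self ((k : ℤ) : ℝ); have hkb := neg_abs_le ((k : ℤ) : ℝ)
      have e1 : ∑ i ∈ range p, f i k = ΦΛ k * ΦΛ k := by
        simp only [hf, hΦΛ]; rw [mul_sum]; exact sum_congr rfl fun i _ => by ring
      have hcol : ΦΛ k ≤ 1 / (lam' + k) + 1 / (lam' - k) := by
        have e2 : ΦΛ k = ∑ i ∈ range p, Λ ^ i / ((L₂ : ℝ) + k) ^ (i + 1) + ∑ i ∈ range p, Λ ^ i / ((L₂ : ℝ) - k) ^ (i + 1) := by
          simp only [hΦΛ, hΦa]; rw [← sum_add_distrib]; exact sum_congr rfl fun i _ => by ring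
        rw [e2]
        have ha := geom_collapse_le p (a := (L₂ : ℝ) + k) hΛ (by linarith)
        have hb := geom_collapse_le p (a := (L₂ : ℝ) - k) hΛ (by linarith)
        have ea : (L₂ : ℝ) + k - Λ = lam' + k := by rw [hlam']; ring
        have eb : (L₂ : ℝ) - k - Λ = lam' - k := by rw [hlam']; ring
        rw [ea] at ha; rw [eb] at hb
        exact add_le_add ha hb
      have hl1 : 0 < lam' + k := by linarith
      have hl2 : 0 < lam' - k := by linarith
      have hl3 : lam' ^ 2 - (k : ℝ) ^ 2 ≠ 0 := by
        have : lam' ^ 2 - (k : ℝ) ^ 2 = (lam' + k) * (lam' - k) := by ring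
        rw [this]; positivity
      have e3 : 1 / (lam' + k) + 1 / (lam' - k) = 2 * lam' / (lam' ^ 2 - (k : ℝ) ^ 2) := by
        field_simp; ring
      have e4 : (2 * lam' / (lam' ^ 2 - (k : ℝ) ^ 2)) ^ 2 = 4 * lam' ^ 2 / (lam' ^ 2 - (k : ℝ) ^ 2) ^ 2 := by
        rw [div_pow]; ring
      rw [e1, ← sq, ← e4, ← e3]
      exact pow_le_pow_left₀ (hΦΛ0 k hk) hcol 2
    have hKabs : |(K : ℤ)| ≤ (K : ℤ) := by rw [abs_of_nonneg (by positivity)]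
    calc ∑ i ∈ range p, (2 * f i K + 1 / N * ∑ m ∈ Icc (-(K : ℤ)) K, f i m)
        = 2 * ∑ i ∈ range p, f i K + 1 / N * ∑ m ∈ Icc (-(K : ℤ)) K, ∑ i ∈ range p, f i m := by
          rw [sum_add_distrib, ← mul_sum, ← mul_sum, sum_comm]
      _ ≤ 2 * (4 * lam' ^ 2 / (lam' ^ 2 - ((K : ℤ) : ℝ) ^ 2) ^ 2) +
          1 / N * ∑ m ∈ Icc (-(K : ℤ)) K, 4 * lam' ^ 2 / (lam' ^ 2 - (m : ℝ) ^ 2) ^ 2 := by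
          refine add_le_add (mul_le_mul_of_nonneg_left (hsq K hKabs) (by norm_num))
            (mul_le_mul_of_nonneg_left (sum_le_sum fun m hm => hsq m (abs_le.mpr (mem_Icc.mp hm))) (by positivity))
      _ ≤ 2 * (4 * lam' ^ 2 / (lam' ^ 2 - ((K : ℤ) : ℝ) ^ 2) ^ 2) +
          1 / N * (8 * (((K : ℤ) : ℝ) + 1 / 2) / (lam' ^ 2 - (((K : ℤ) : ℝ) + 1 / 2) ^ 2)) := by
          refine add_le_add le_rfl (mul_le_mul_of_nonneg_left ?_ (by positivity))
          exact sum_Icc_edgeSq_le (K := (K : ℤ)) (by positivity) (by push_cast; linarith)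
      _ = _ := by
          have hK1 : 0 < lam' ^ 2 - (K : ℝ) ^ 2 := by nlinarith
          have hK2 : 0 < lam' ^ 2 - ((K : ℝ) + 1 / 2) ^ 2 := by nlinarith
          push_cast
          field_simp
          ring

/-! ## §2 The remainder scalars -/

/-- **The remainder weight in closed form**: for a window with `|k| + L + D ≤ λ` (`D ≥ 1`) and `p ≥ 1`, every residue class `ρ`:
`Σ_{k∈W, k≡ρ} ((1/(λ+k)^p + 1/(λ−k)^p)/D)² ≤ (4/D²)(1/S^{2p} + 1/(N·S^{2p−1}))`, `S = D + L`. [folklore] -/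
theorem cornerTraceGeom_sigma_le {N : ℕ} (hN : 0 < N) {L₂ L D : ℕ} (hD : 0 < D) (W : Finset ℤ)
    (hW : ∀ k ∈ W, |k| + L + D ≤ (L₂ : ℤ)) {p : ℕ} (hp : 1 ≤ p) (ρ : ℤ) :
    ∑ k ∈ W.filter (fun k => (N : ℤ) ∣ k - ρ), ((1 / ((L₂ : ℝ) + k) ^ p + 1 / ((L₂ : ℝ) - k) ^ p) / D) ^ 2 ≤
      4 / (D : ℝ) ^ 2 * (1 / ((D : ℝ) + L) ^ (2 * p) + 1 / (N * ((D : ℝ) + L) ^ (2 * p - 1))) := by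
  classical
  have hNr : (0 : ℝ) < N := by exact_mod_cast hN
  have hDr : (0 : ℝ) < D := by exact_mod_cast hD
  set S : ℝ := (D : ℝ) + L with hS
  have hS0 : 0 < S := by positivity
  set Wρ := W.filter (fun k => (N : ℤ) ∣ k - ρ) with hWρ
  have hmem : ∀ k ∈ Wρ, S ≤ (L₂ : ℝ) + k ∧ S ≤ (L₂ : ℝ) - k := by
    intro k hk
    have h1 := hW k (mem_filter.mp hk).1
    have h1' : |((k : ℤ) : ℝ)| + L + D ≤ L₂ := by exact_mod_cast h1
    have := le_abs_self ((k : ℤ) : ℝ); have := neg_abs_le ((k : ℤ) : ℝ)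
    constructor <;> [skip; skip] <;> (rw [hS]; linarith)
  have hmodW : ∀ k ∈ Wρ, ∀ k' ∈ Wρ, k ≡ k' [ZMOD N] := by
    intro k hk k' hk'
    have h1 := (mem_filter.mp hk).2
    have h2 := (mem_filter.mp hk').2
    have : (N : ℤ) ∣ k' - k := by have := dvd_sub h2 h1; rwa [show k' - ρ - (k - ρ) = k' - k by ring] at this
    exact (Int.modEq_iff_dvd.mpr this)
  -- the two `Σ 1/(λ±k)²` sums
  have hplus : ∑ k ∈ Wρ, 1 / ((L₂ : ℝ) + k) ^ 2 ≤ 1 / S ^ 2 + 1 / (N * S) := by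
    have hinj : Set.InjOn (fun k : ℤ => (L₂ : ℤ) + k) Wρ := fun a _ b _ h => by simpa using h
    have hs := sum_inv_sq_le_of_modEq hN (Wρ.image fun k => (L₂ : ℤ) + k) ((D : ℤ) + L) (by positivity)
      (fun u hu => by
        obtain ⟨k, hk, rfl⟩ := mem_image.mp hu
        have := hW k (mem_filter.mp hk).1
        have := neg_abs_le k
        omega)
      (fun u hu v hv => by
        obtain ⟨k, hk, rfl⟩ := mem_image.mp hu
        obtain ⟨k', hk', rfl⟩ := mem_image.mp hv
        exact (hmodW k hk k' hk').add_left _)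
    rw [sum_image hinj] at hs
    push_cast at hs
    simpa only [hS] using hs
  have hminus : ∑ k ∈ Wρ, 1 / ((L₂ : ℝ) - k) ^ 2 ≤ 1 / S ^ 2 + 1 / (N * S) := by
    have hinj : Set.InjOn (fun k : ℤ => (L₂ : ℤ) - k) Wρ := fun a _ b _ h => by simpa using h
    have hs := sum_inv_sq_le_of_modEq hN (Wρ.image fun k => (L₂ : ℤ) - k) ((D : ℤ) + L) (by positivity)
      (fun u hu => by
        obtain ⟨k, hk, rfl⟩ := mem_image.mp hu
        have := hW k (mem_filter.mp hk).1
        have := le_abs_self k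
        omega)
      (fun u hu v hv => by
        obtain ⟨k, hk, rfl⟩ := mem_image.mp hu
        obtain ⟨k', hk', rfl⟩ := mem_image.mp hv
        exact (hmodW k hk k' hk').sub_left _)
    rw [sum_image hinj] at hs
    push_cast at hs
    simpa only [hS] using hs
  -- pointwise: `((x+y)/D)² ≤ (2/D²)(x²+y²)` and `1/(λ±k)^{2p} ≤ (1/(λ±k)²)/S^{2p−2}`
  have hpt : ∀ k ∈ Wρ, ((1 / ((L₂ : ℝ) + k) ^ p + 1 / ((L₂ : ℝ) - k) ^ p) / D) ^ 2 ≤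
      2 / (D : ℝ) ^ 2 * ((1 / ((L₂ : ℝ) + k) ^ 2) / S ^ (2 * p - 2) + (1 / ((L₂ : ℝ) - k) ^ 2) / S ^ (2 * p - 2)) := by
    intro k hk
    obtain ⟨ha, hb⟩ := hmem k hk
    have ha0 : 0 < (L₂ : ℝ) + k := lt_of_lt_of_le hS0 ha
    have hb0 : 0 < (L₂ : ℝ) - k := lt_of_lt_of_le hS0 hb
    have hpow : ∀ x : ℝ, S ≤ x → 0 < x → (1 / x ^ p) ^ 2 ≤ (1 / x ^ 2) / S ^ (2 * p - 2) := by
      intro x hx hx0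
      have e : (1 / x ^ p) ^ 2 = (1 / x ^ 2) / x ^ (2 * p - 2) := by
        rw [div_div, ← pow_add, show 2 + (2 * p - 2) = 2 * p by omega, one_div_pow, ← pow_mul, mul_comm]
      rw [e]
      exact div_le_div_of_nonneg_left (by positivity) (by positivity) (pow_le_pow_left₀ hS0.le hx _)
    have h2 : ((1 / ((L₂ : ℝ) + k) ^ p + 1 / ((L₂ : ℝ) - k) ^ p) / D) ^ 2 ≤
        2 / (D : ℝ) ^ 2 * ((1 / ((L₂ : ℝ) + k) ^ p) ^ 2 + (1 / ((L₂ : ℝ) - k) ^ p) ^ 2) := by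
      rw [div_pow]
      have : (1 / ((L₂ : ℝ) + k) ^ p + 1 / ((L₂ : ℝ) - k) ^ p) ^ 2 ≤
          2 * ((1 / ((L₂ : ℝ) + k) ^ p) ^ 2 + (1 / ((L₂ : ℝ) - k) ^ p) ^ 2) := by
        nlinarith [sq_nonneg (1 / ((L₂ : ℝ) + k) ^ p - 1 / ((L₂ : ℝ) - k) ^ p)]
      calc (1 / ((L₂ : ℝ) + k) ^ p + 1 / ((L₂ : ℝ) - k) ^ p) ^ 2 / (D : ℝ) ^ 2
          ≤ 2 * ((1 / ((L₂ : ℝ) + k) ^ p) ^ 2 + (1 / ((L₂ : ℝ) - k) ^ p) ^ 2) / (D : ℝ) ^ 2 :=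
            div_le_div_of_nonneg_right this (by positivity)
        _ = _ := by ring
    exact h2.trans (mul_le_mul_of_nonneg_left (add_le_add (hpow _ ha ha0) (hpow _ hb hb0)) (by positivity))
  calc ∑ k ∈ Wρ, ((1 / ((L₂ : ℝ) + k) ^ p + 1 / ((L₂ : ℝ) - k) ^ p) / D) ^ 2
      ≤ ∑ k ∈ Wρ, 2 / (D : ℝ) ^ 2 * ((1 / ((L₂ : ℝ) + k) ^ 2) / S ^ (2 * p - 2) + (1 / ((L₂ : ℝ) - k) ^ 2) / S ^ (2 * p - 2)) :=
        sum_le_sum hpt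
    _ = 2 / (D : ℝ) ^ 2 * ((∑ k ∈ Wρ, 1 / ((L₂ : ℝ) + k) ^ 2) / S ^ (2 * p - 2) +
          (∑ k ∈ Wρ, 1 / ((L₂ : ℝ) - k) ^ 2) / S ^ (2 * p - 2)) := by
        rw [← mul_sum, sum_add_distrib, sum_div, sum_div]
    _ ≤ 2 / (D : ℝ) ^ 2 * ((1 / S ^ 2 + 1 / (N * S)) / S ^ (2 * p - 2) + (1 / S ^ 2 + 1 / (N * S)) / S ^ (2 * p - 2)) := by
        gcongr
    _ = 4 / (D : ℝ) ^ 2 * (1 / S ^ (2 * p) + 1 / (N * S ^ (2 * p - 1))) := by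
        have e1 : S ^ (2 * p) = S ^ 2 * S ^ (2 * p - 2) := by rw [← pow_add]; congr 1; omega
        have e2 : S ^ (2 * p - 1) = S * S ^ (2 * p - 2) := by rw [← pow_succ']; congr 1; omega
        rw [e1, e2]
        field_simp
        ring

/-- **The moment scalar in closed form**: for `S ⊆ [−L, L]`, every `k`: `Σ_{l∈S, N∣k−l} |l|^{2p} ≤ (2L/N + 1)·L^{2p}`. [folklore] -/
theorem cornerTraceGeom_moment_le {N : ℕ} (hN : 0 < N) (S : Finset ℤ) {L : ℕ} (hS : ∀ l ∈ S, |l| ≤ (L : ℤ)) (p : ℕ) (k : ℤ) :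
    ∑ l ∈ S.filter (fun l => (N : ℤ) ∣ k - l), |(l : ℝ)| ^ (2 * p) ≤ (2 * (L : ℝ) / N + 1) * (L : ℝ) ^ (2 * p) := by
  classical
  have hsub : S.filter (fun l => (N : ℤ) ∣ k - l) ⊆ (Icc (-(L : ℤ)) L).filter (fun l => (N : ℤ) ∣ k - l) := by
    intro l hl
    obtain ⟨hlS, hld⟩ := mem_filter.mp hl
    exact mem_filter.mpr ⟨mem_Icc.mpr (abs_le.mp (hS l hlS)), hld⟩
  have hcard := card_filter_Icc_dvd_sub_le hN L k
  calc ∑ l ∈ S.filter (fun l => (N : ℤ) ∣ k - l), |(l : ℝ)| ^ (2 * p)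
      ≤ ∑ l ∈ (Icc (-(L : ℤ)) L).filter (fun l => (N : ℤ) ∣ k - l), |(l : ℝ)| ^ (2 * p) :=
        sum_le_sum_of_subset_of_nonneg hsub fun _ _ _ => by positivity
    _ ≤ ∑ l ∈ (Icc (-(L : ℤ)) L).filter (fun l => (N : ℤ) ∣ k - l), (L : ℝ) ^ (2 * p) := by
        refine sum_le_sum fun l hl => ?_
        have h := mem_Icc.mp (mem_filter.mp hl).1
        have : |(l : ℝ)| ≤ L := by rw [← Int.cast_abs]; exact_mod_cast abs_le.mpr h
        exact pow_le_pow_left₀ (abs_nonneg _) this _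
    _ = (((Icc (-(L : ℤ)) L).filter (fun l => (N : ℤ) ∣ k - l)).card : ℝ) * (L : ℝ) ^ (2 * p) := by
        rw [sum_const, nsmul_eq_mul]
    _ ≤ (2 * (L : ℝ) / N + 1) * (L : ℝ) ^ (2 * p) := mul_le_mul_of_nonneg_right hcard (by positivity)

end Summit.AnomalousDissipation.AnomalousDissipation.Theorems.SawtoothPulseCascade.K1Window
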